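import Literature.NumberTheory.Automorphic.ParabolicSemidirect
import Literature.NumberTheory.Automorphic.IwasawaDecompositionGL
import HarnessLib

/-!
# The standard Levi subgroup `M_c ≤ GL_n`: block-diagonal membership, the centraliser of a regular
# block scalar, `M_c × U_c ≃ₜ P_c` inside `GL_n`, and the Iwasawa decomposition `GL_n(F) = GL_n(𝒪) P_c(F)`

Topic `NumberTheory/Automorphic`; namespace `Literature.NumberTheory.Automorphic`. KERNEL mathematics
only: theorems, no definition, no named fact, no instance, no `sorry`. Structural glue around the
tree's standard parabolic `P_c = standardParabolicGL R c` (`ParabolicGL`: block labelling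
`c : n → α`, Levi subgroup `standardLeviGL R c = range (leviEmbedding R c)`, unipotent radical
`unipotentRadicalGL R c`, `leviUnipotentHomeomorph` of `ParabolicSemidirect`, Iwasawa decomposition
`exists_borel_mul_glInt` of `IwasawaDecompositionGL`), in the form consumed by the integration of
orbital integrals in Iwasawa coordinates (`KNAQuotientIntegration`: subgroups `K, A, N ≤ B` of ONE
ambient group `G`, `G = K B`, `A × N ≃ₜ B`):

* §1 `mem_standardLeviGL_iff` — **`g ∈ M_c ↔ g_{ij} = 0` whenever `c i ≠ c j`** (block diagonal);
  `conj_mem_unipotentRadicalGL_of_mem_standardLeviGL` (`M_c` normalises `U_c`);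
  `coe_blockDiagonalGL_scalar` (the block scalar `diag(t_{c(i)})`) and
  **`centralizer_blockDiagonalGL_scalar_eq_standardLeviGL`**: if the scalars `t_a ∈ Rˣ` have unit
  differences (`t_a - t_b ∈ Rˣ` for `a ≠ b`; over a field: pairwise distinct), the centraliser in
  `GL_n(R)` of `z = diag(t_{c(i)})_i` IS `M_c` — e.g. `C_{GL_3}(diag(e₁, e₁, e₂)) = GL_2 × GL_1` for
  `e₁ ≠ e₂`, the `M`-central `(G, M)`-regular point of Rogawski 1990, §4.13;
* §2 `exists_homeomorph_levi_prod_unipotent_coe_eq` — **a homeomorphism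
  `e : M_c × U_c ≃ₜ P_c` with `e(m, u) = m u`** for `M_c`, `U_c`, `P_c` as subgroups of `GL_n(R)`
  (`R` a topological commutative ring; transport of `leviUnipotentHomeomorph`; existence form, no
  definition);
* §3 `exists_glInt_mul_mem_standardParabolicGL` — **`GL_n(F) = GL_n(𝒪) · P_c(F)`** for a monotone
  labelling `c : Fin n → α` and the valuation ring `𝒪` of any valuative relation on a field `F`
  (`g⁻¹ = b k` with `b` upper triangular, `B ⊆ P_c`).

## References

* [BernsteinZelevinsky1977] I. N. Bernstein, A. V. Zelevinsky, *Induced representations of reductive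
  `p`-adic groups I*, Ann. Sci. ÉNS 10 (1977), §2.1 (`P_β = M_β ⋉ U_β`, `M_β`, `U_β`).
* [Bump1997] D. Bump, *Automorphic Forms and Representations* (1997), Prop. 4.5.2 (Iwasawa
  decomposition of `GL_n` over a non-archimedean local field).
* [Rogawski1990] J. D. Rogawski, *Automorphic Representations of Unitary Groups in Three Variables*
  (1990), §4.13 p. 70 (`H_{vγ} = G_{vγ}` for `(G, H)`-regular `γ`, `P` of type `(2, 1)`).
-/

noncomputable section

open scoped MatrixGroups
open Matrix

namespace Literature.NumberTheory.Automorphic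

/-! ### 1. Membership in the standard Levi subgroup -/

section Levi

variable {R : Type*} [CommRing R] {n : Type*} [Fintype n] [DecidableEq n] {α : Type*}
  [LinearOrder α] [Fintype α] (c : n → α)

/-- **`g ∈ M_c` iff its off-diagonal blocks vanish**: the standard Levi subgroup
`standardLeviGL R c` (the range of the block-diagonal embedding `Π_a GL_{n_a}(R) → GL_n(R)`) consists
exactly of the invertible matrices `g` with `g_{ij} = 0` whenever `c i ≠ c j`.
(Bernstein–Zelevinsky 1977, §2.1: `M_β`.) [cite: BernsteinZelevinsky1977, §2.1] -/
theorem mem_standardLeviGL_iff (g : GL n R) :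
    g ∈ standardLeviGL R c ↔ ∀ i j, c i ≠ c j → (g : Matrix n n R) i j = 0 := by
  constructor
  · rintro ⟨m, rfl⟩ i j hij
    rw [leviEmbedding_apply, blockDiagonalGL_apply_coe_dite, dif_neg hij]
  · intro hg
    have hgP : g ∈ standardParabolicGL R c := fun i j hij => hg i j hij.ne'
    refine ⟨leviProjection R c ⟨g, hgP⟩, Units.ext ?_⟩
    rw [leviEmbedding_apply]
    ext i j
    rw [blockDiagonalGL_apply_coe_dite]
    by_cases hij : c i = c j
    · rw [dif_pos hij, leviProjection_apply_coe]
    · rw [dif_neg hij, hg i j hij]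

/-- `M_c` normalises `U_c`: `m u m⁻¹ ∈ U_c` for `m ∈ M_c`, `u ∈ U_c` (indeed `U_c` is normal in
`P_c ⊇ M_c`). [cite: BernsteinZelevinsky1977, §2.1] -/
theorem conj_mem_unipotentRadicalGL_of_mem_standardLeviGL {m u : GL n R}
    (hm : m ∈ standardLeviGL R c) (hu : u ∈ unipotentRadicalGL R c) :
    m * u * m⁻¹ ∈ unipotentRadicalGL R c := by
  have hmP : m ∈ standardParabolicGL R c := standardLeviGL_le R c hm
  have huP : u ∈ standardParabolicGL R c := unipotentRadicalGL_le R c hu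
  have hu' : (⟨u, huP⟩ : standardParabolicGL R c) ∈ unipotentRadicalP R c := by
    rw [← unipotentRadicalGL_subgroupOf]; exact hu
  have h := (inferInstance : (unipotentRadicalP R c).Normal).conj_mem _ hu' ⟨m, hmP⟩
  rw [← unipotentRadicalGL_subgroupOf, Subgroup.mem_subgroupOf] at h
  exact h

/-- The matrix of the **block scalar** `diag(t_{c(i)})_i`, the image of the family of scalar
matrices `(t_a · 1)_a` under the block-diagonal embedding. [cite: BernsteinZelevinsky1977, §2.1] -/
theorem coe_blockDiagonalGL_scalar (t : α → Rˣ) :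
    ((blockDiagonalGL R c fun a => Matrix.GeneralLinearGroup.scalar {i // c i = a} (t a) :
        GL n R) : Matrix n n R) = Matrix.diagonal fun i => (t (c i) : R) := by
  ext i j
  rw [blockDiagonalGL_apply_coe_dite]
  by_cases hij : c i = c j
  · rw [dif_pos hij, Matrix.GeneralLinearGroup.coe_scalar, Matrix.scalar_apply,
      Matrix.diagonal_apply, Matrix.diagonal_apply]
    by_cases h : i = j
    · subst h; simp
    · rw [if_neg (fun h' => h (congrArg Subtype.val h')), if_neg h]
  · rw [dif_neg hij, Matrix.diagonal_apply, if_neg (fun h => hij (congrArg c h))]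

/-- **The centraliser of a regular block scalar is the Levi subgroup**: if the scalars `t_a` have
UNIT differences `t_a - t_b ∈ Rˣ` for `a ≠ b` (over a field: are pairwise distinct), then the
centraliser in `GL_n(R)` of `z = diag(t_{c(i)})_i` is `M_c` — `g z = z g` reads
`(t_{c(j)} - t_{c(i)}) g_{ij} = 0`. (For `GL_3 ⊃ M = GL_2 × GL_1` and `z = diag(e₁, e₁, e₂)`,
`e₁ ≠ e₂`: `C_G(z) = M` — the `(G, M)`-regular, `M`-central point of Rogawski 1990, §4.13.)
[cite: BernsteinZelevinsky1977, §2.1] -/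
theorem centralizer_blockDiagonalGL_scalar_eq_standardLeviGL (t : α → Rˣ)
    (ht : ∀ a b, a ≠ b → IsUnit ((t a : R) - t b)) :
    Subgroup.centralizer
        {(blockDiagonalGL R c fun a => Matrix.GeneralLinearGroup.scalar {i // c i = a} (t a) :
          GL n R)} = standardLeviGL R c := by
  ext g
  rw [Subgroup.mem_centralizer_singleton_iff, mem_standardLeviGL_iff]
  constructor
  · intro h i j hij
    have h' := congrArg (fun u : GL n R => (u : Matrix n n R) i j) h
    simp only [Units.val_mul, coe_blockDiagonalGL_scalar, Matrix.mul_diagonal,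
      Matrix.diagonal_mul] at h'
    -- h' : t (c i) * g i j = g i j * t (c j)
    have h2 : ((t (c i) : R) - t (c j)) * (g : Matrix n n R) i j = 0 := by
      rw [sub_mul, ← h', mul_comm ((g : Matrix n n R) i j), sub_self]
    exact (ht _ _ hij).mul_right_eq_zero.1 h2
  · intro h
    apply Units.ext
    rw [Units.val_mul, Units.val_mul, coe_blockDiagonalGL_scalar]
    ext i j
    rw [Matrix.mul_diagonal, Matrix.diagonal_mul]
    by_cases hij : c i = c j
    · rw [hij, mul_comm]
    · rw [h i j hij, mul_zero, zero_mul]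

end Levi

/-! ### 2. `M_c × U_c ≃ₜ P_c` as subgroups of `GL_n(R)` -/

section Homeomorph

variable (R : Type*) [CommRing R] [TopologicalSpace R] [IsTopologicalRing R] {n : Type*}
  [Fintype n] [DecidableEq n] {α : Type*} [LinearOrder α] [Fintype α] (c : n → α)

/-- **`(m, u) ↦ m u` is a homeomorphism `M_c × U_c ≃ₜ P_c`** for the Levi subgroup and the unipotent
radical as subgroups of `GL_n(R)` (the tree's `leviUnipotentHomeomorph` is the same statement for
`M_c`, `U_c` as subgroups of `P_c`; this is its transport along the tautological identifications
`standardLeviGL ≃ leviP`, `unipotentRadicalGL ≃ unipotentRadicalP`). Existence form, so that no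
definition is introduced. (Bernstein–Zelevinsky 1977, §2.1: `P_β = M_β ⋉ U_β`.)
[cite: BernsteinZelevinsky1977, §2.1] -/
theorem exists_homeomorph_levi_prod_unipotent_coe_eq :
    ∃ e : ↥(standardLeviGL R c) × ↥(unipotentRadicalGL R c) ≃ₜ ↥(standardParabolicGL R c),
      ∀ q, ((e q : standardParabolicGL R c) : GL n R) = (q.1 : GL n R) * (q.2 : GL n R) := by
  -- `M_c ≃ₜ leviP`
  let h₁ : ↥(standardLeviGL R c) ≃ₜ ↥(leviP R c) :=
  { toFun := fun x => ⟨⟨x.1, standardLeviGL_le R c x.2⟩, (Subgroup.mem_subgroupOf).2 x.2⟩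
    invFun := fun y => ⟨y.1.1, (Subgroup.mem_subgroupOf).1 y.2⟩
    left_inv := fun x => rfl
    right_inv := fun y => rfl
    continuous_toFun := (continuous_subtype_val.subtype_mk _).subtype_mk _
    continuous_invFun := (continuous_subtype_val.comp continuous_subtype_val).subtype_mk _ }
  -- `U_c ≃ₜ unipotentRadicalP`
  have hmem : ∀ x : ↥(unipotentRadicalGL R c),
      (⟨x.1, unipotentRadicalGL_le R c x.2⟩ : standardParabolicGL R c) ∈ unipotentRadicalP R c :=
    fun x => by rw [← unipotentRadicalGL_subgroupOf, Subgroup.mem_subgroupOf]; exact x.2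
  have hmem' : ∀ p : standardParabolicGL R c, p ∈ unipotentRadicalP R c →
      (p : GL n R) ∈ unipotentRadicalGL R c := fun p hp => by
    rw [← unipotentRadicalGL_subgroupOf, Subgroup.mem_subgroupOf] at hp
    exact hp
  let h₂ : ↥(unipotentRadicalGL R c) ≃ₜ ↥(unipotentRadicalP R c) :=
  { toFun := fun x => ⟨⟨x.1, unipotentRadicalGL_le R c x.2⟩, hmem x⟩
    invFun := fun y => ⟨y.1.1, hmem' y.1 y.2⟩
    left_inv := fun x => rfl
    right_inv := fun y => rfl
    continuous_toFun := (continuous_subtype_val.subtype_mk _).subtype_mk _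
    continuous_invFun := (continuous_subtype_val.comp continuous_subtype_val).subtype_mk _ }
  refine ⟨(Homeomorph.prodCongr h₁ h₂).trans (leviUnipotentHomeomorph R c), fun q => ?_⟩
  rfl

end Homeomorph

/-! ### 3. The Iwasawa decomposition `GL_n(F) = GL_n(𝒪) · P_c(F)` for a monotone labelling -/

section Iwasawa

variable {F : Type*} [Field F] [ValuativeRel F] {n : ℕ} {α : Type*} [LinearOrder α]
  {c : Fin n → α}

/-- **Iwasawa decomposition relative to a standard parabolic**: for a monotone block labelling
`c : Fin n → α`, every `g ∈ GL_n(F)` is `g = k p` with `k ∈ GL_n(𝒪)` and `p ∈ P_c(F)` (`𝒪` the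
valuation ring of any valuative relation on the field `F`) — from `GL_n(F) = B(F) GL_n(𝒪)`
(`exists_borel_mul_glInt`, applied to `g⁻¹`) and `B ⊆ P_c`. (Bump 1997, Prop. 4.5.2; Cartier 1979,
§IV: `G = KP`.) [cite: Bump1997, Prop. 4.5.2] -/
theorem exists_glInt_mul_mem_standardParabolicGL (hc : Monotone c) (g : GL (Fin n) F) :
    ∃ k ∈ glInt n F, ∃ p ∈ standardParabolicGL F c, g = k * p := by
  obtain ⟨b, hb, k, hk, h⟩ := exists_borel_mul_glInt g⁻¹
  have hbc : b⁻¹ ∈ standardParabolicGL F c := by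
    refine Subgroup.inv_mem _ ?_
    rw [mem_standardParabolicGL_iff] at hb ⊢
    intro i j hij
    exact hb (lt_of_not_ge fun hle => absurd (hc hle) (not_le.2 hij))
  refine ⟨k⁻¹, Subgroup.inv_mem _ hk, b⁻¹, hbc, ?_⟩
  rw [← _root_.mul_inv_rev, ← h, inv_inv]

end Iwasawa

end Literature.NumberTheory.Automorphic
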